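import Literature.Analysis.FunctionSpaces.BathtubPrinciple
import Literature.Analysis.Fourier.VanDerCorputSublevel
import Mathlib.Analysis.SpecialFunctions.Integrals.Basic
import Mathlib.Analysis.MeanInequalitiesPow
import HarnessLib

/-!
# Integrals of logarithmic singularities from sublevel set estimates

Topic `Literature/Analysis/Fourier` (companion of `VanDerCorputSublevel.lean`). If a function `ξ`
on `[a, b]` obeys a sublevel set estimate of van der Corput type, `vol{u ∈ [a,b] : |ξ u| ≤ t} ≤ A t^θ`
(`θ = 1`, `A = 2/g` when `|ξ'| ≥ g`; `θ = 1/2`, `A = 6/√δ` when `|ξ''| ≥ δ` — Carbery–Christ–Wright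
§1), then an integrand with a logarithmic singularity on the unknown level set `{ξ = 0}` has an
explicitly bounded integral over the cell — by the layer-cake representation and, when a monotone
singular weight is present, the bathtub / Hardy–Littlewood rearrangement bound
(`Literature/Analysis/FunctionSpaces/BathtubPrinciple.lean`):

* `integral_posLog_le_of_volume_sublevel_le`:
  `∫_{[a,b]} log⁺(C/|ξ u|) du ≤ (b-a) (θ⁻¹ log⁺(A C^θ/(b-a)) + θ⁻¹)` (with integrability);
* `integral_rpow_mul_posLog_le_of_volume_sublevel_le` (`0 ≤ a`, `0 < p ≤ 1`):
  `∫_{[a,b]} p u^{p-1} log⁺(C/|ξ u|) du ≤ (b-a)^p (θ⁻¹ log⁺(A C^θ/(b-a)) + (pθ)⁻¹)`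
  (`p = 1/2`: the weight `u^{-1/2}/2` of a square-root density of states; `p = 1/4`: `u^{-3/4}/4`);
* the order-one and order-two instances `integral_posLog_le_of_deriv_ge` / `_of_deriv_le`
  (`(b-a)(log⁺(2C/(g(b-a))) + 1)`) and `integral_posLog_le_of_second_deriv_ge`
  (`(b-a)(2 log⁺(6√C/(√δ (b-a))) + 2)`), hypotheses verbatim those of `VanDerCorputSublevel.lean`;
* Lebesgue-integral forms `lintegral_posLog_le_of_volume_sublevel_le`,
  `lintegral_rpow_mul_posLog_le_of_volume_sublevel_le`.

## References
* [CarberyChristWright1999] A. Carbery, M. Christ, J. Wright, *Multidimensional van der Corput and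
  sublevel set estimates*, J. Amer. Math. Soc. 12 (1999) 981–1015, §1.
* [LiebLoss2001] E. H. Lieb, M. Loss, *Analysis*, 2nd ed., AMS (2001), Thm 1.13, Thm 1.14.
* [HardyLittlewoodPolya1952] G. H. Hardy, J. E. Littlewood, G. Pólya, *Inequalities*, CUP (1952),
  Thm 378.
-/

noncomputable section

open MeasureTheory Set Real Literature.Analysis.FunctionSpaces
open scoped ENNReal

namespace Literature.Analysis.Fourier

/-! ### Logarithmic singularities from sublevel set estimates -/

/-- Measurability of `u ↦ log⁺ (C / |ξ u|)` along `(a, b]` from that of `ξ`.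
[cite: LiebLoss2001, Thm 1.13] -/
theorem aemeasurable_posLog_div_abs {ξ : ℝ → ℝ} {s : Set ℝ} (C : ℝ)
    (hξ : AEMeasurable ξ (volume.restrict s)) :
    AEMeasurable (fun u => log⁺ (C / |ξ u|)) (volume.restrict s) :=
  continuous_posLog.measurable.comp_aemeasurable
    (measurable_const.aemeasurable.div (continuous_abs.measurable.comp_aemeasurable hξ))

/-- The superlevel sets of `log⁺(C/|ξ|)` are sublevel sets of `|ξ|`: for `τ > 0`,
`τ < log⁺(C/|ξ u|) ⟹ |ξ u| ≤ C e^{-τ}`. [cite: LiebLoss2001, Thm 1.13] -/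
theorem abs_le_of_lt_posLog_div {C τ x : ℝ} (hC : 0 < C) (hτ : 0 < τ) (h : τ < log⁺ (C / |x|)) :
    |x| ≤ C * exp (-τ) := by
  have hpos : 0 < log⁺ (C / |x|) := hτ.trans h
  have hx : 0 < |x| := by
    rcases eq_or_lt_of_le (abs_nonneg x) with h0 | h0
    · exfalso; rw [← h0, div_zero] at hpos; simp [posLog] at hpos
    · exact h0
  have hq : 0 < C / |x| := div_pos hC hx
  have h1 : 1 < C / |x| := by
    by_contra hle
    have : log⁺ (C / |x|) = 0 := (posLog_eq_zero_iff _).2 (by rw [abs_of_pos hq]; exact not_lt.1 hle)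
    linarith
  rw [posLog_eq_log (by rw [abs_of_pos hq]; exact h1.le), lt_log_iff_exp_lt hq,
    lt_div_iff₀ hx] at h
  rw [exp_neg, ← div_eq_mul_inv, le_div_iff₀ (exp_pos τ)]
  linarith [mul_comm (exp τ) (|x|)]

/-- Under a power-law sublevel estimate `vol{u ∈ [a,b] : |ξ u| ≤ t} ≤ A t^θ`, the superlevel
sets of `log⁺(C/|ξ|)` in `(a, b]` have measure `≤ min(b - a, A C^θ e^{-θτ})`.
[cite: LiebLoss2001, Thm 1.13] -/
theorem volume_superlevel_posLog_le {ξ : ℝ → ℝ} {a b θ A C : ℝ} (hC : 0 < C)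
    (hsub : ∀ t, 0 < t → volume {u ∈ Icc a b | |ξ u| ≤ t} ≤ ENNReal.ofReal (A * t ^ θ))
    {τ : ℝ} (hτ : 0 < τ) :
    volume {u ∈ Ioc a b | τ < log⁺ (C / |ξ u|)} ≤
      ENNReal.ofReal (min (b - a) (A * C ^ θ * exp (-θ * τ))) := by
  rw [ENNReal.ofReal_min]
  refine le_min ?_ ?_
  · calc volume {u ∈ Ioc a b | τ < log⁺ (C / |ξ u|)} ≤ volume (Ioc a b) :=
          measure_mono fun u hu => hu.1
      _ = ENNReal.ofReal (b - a) := Real.volume_Ioc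
  · calc volume {u ∈ Ioc a b | τ < log⁺ (C / |ξ u|)}
        ≤ volume {u ∈ Icc a b | |ξ u| ≤ C * exp (-τ)} :=
          measure_mono fun u hu => ⟨Ioc_subset_Icc_self hu.1, abs_le_of_lt_posLog_div hC hτ hu.2⟩
      _ ≤ ENNReal.ofReal (A * (C * exp (-τ)) ^ θ) := hsub _ (mul_pos hC (exp_pos _))
      _ = ENNReal.ofReal (A * C ^ θ * exp (-θ * τ)) := by
          rw [mul_rpow hC.le (exp_pos _).le, ← exp_mul]; ring_nf

/-- **Unweighted logarithmic singularity.** If `a < b`, `0 < θ`, `0 ≤ A`, `0 < C`, `ξ` is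
a.e.-measurable on `[a, b]` and `vol{u ∈ [a,b] : |ξ u| ≤ t} ≤ A t^θ` for all `t > 0`, then
`∫_{[a,b]} log⁺(C/|ξ u|) du ≤ (b-a) (θ⁻¹ log⁺(A C^θ/(b-a)) + θ⁻¹)` (Lebesgue integral form).
[cite: LiebLoss2001, Thm 1.13] -/
theorem lintegral_posLog_le_of_volume_sublevel_le {ξ : ℝ → ℝ} {a b θ A C : ℝ} (hab : a < b)
    (hθ : 0 < θ) (hA : 0 ≤ A) (hC : 0 < C) (hξ : AEMeasurable ξ (volume.restrict (Icc a b)))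
    (hsub : ∀ t, 0 < t → volume {u ∈ Icc a b | |ξ u| ≤ t} ≤ ENNReal.ofReal (A * t ^ θ)) :
    ∫⁻ u in Icc a b, ENNReal.ofReal (log⁺ (C / |ξ u|)) ≤
      ENNReal.ofReal ((b - a) * (θ⁻¹ * log⁺ (A * C ^ θ / (b - a)) + θ⁻¹)) := by
  have hL : 0 < b - a := sub_pos.2 hab
  set M : ℝ := A * C ^ θ with hM
  have hM0 : 0 ≤ M := mul_nonneg hA (rpow_nonneg hC.le θ)
  set m : ℝ → ℝ := fun τ => min (b - a) (M * exp (-θ * τ)) with hm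
  have hm0 : ∀ τ, 0 < τ → 0 ≤ m τ := fun τ _ => le_min hL.le (mul_nonneg hM0 (exp_pos _).le)
  have hmb : ∀ τ, 0 < τ → a + m τ ≤ b := fun τ _ => by
    have := min_le_left (b - a) (M * exp (-θ * τ)); rw [hm]; linarith
  have hξ' : AEMeasurable ξ (volume.restrict (Ioc a b)) :=
    hξ.mono_measure (Measure.restrict_mono Ioc_subset_Icc_self le_rfl)
  have hlevel : ∀ τ, 0 < τ →
      volume {u ∈ Ioc a b | τ < log⁺ (C / |ξ u|)} ≤ ENNReal.ofReal (m τ) :=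
    fun τ hτ => volume_superlevel_posLog_le hC hsub hτ
  -- layer cake + bathtub with `φ ≡ 1`
  have key := lintegral_mul_le_of_antitoneOn_of_volume_superlevel_le (φ := fun _ => (1:ℝ))
    (ψ := fun u => log⁺ (C / |ξ u|)) (a := a) (b := b) (fun _ _ _ _ _ => le_rfl)
    (fun _ _ => zero_le_one) (aemeasurable_posLog_div_abs C hξ') (fun _ _ => posLog_nonneg)
    hm0 hmb hlevel
  simp only [one_mul, ENNReal.ofReal_one, setLIntegral_const, one_mul, Real.volume_Ioc,
    add_sub_cancel_left] at key
  rw [setLIntegral_congr Ioc_ae_eq_Icc.symm]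
  refine key.trans ?_
  have tail := lintegral_min_exp_rpow_le (M := M) hL hM0 hθ zero_lt_one
  simp only [rpow_one, one_mul] at tail
  refine (le_of_eq ?_).trans tail
  refine setLIntegral_congr_fun measurableSet_Ioi fun τ _ => ?_
  rw [hm]

/-- **Logarithmic singularity against a power weight.** If `0 ≤ a < b`, `0 < p ≤ 1`, `0 < θ`,
`0 ≤ A`, `0 < C`, `ξ` is a.e.-measurable on `[a, b]` and `vol{u ∈ [a,b] : |ξ u| ≤ t} ≤ A t^θ`
for all `t > 0`, then
`∫_{[a,b]} p u^{p-1} log⁺(C/|ξ u|) du ≤ (b-a)^p (θ⁻¹ log⁺(A C^θ/(b-a)) + (pθ)⁻¹)`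
(Hardy–Littlewood: both singular factors rearranged to the left end; `∫_a^{a+x} p u^{p-1} ≤ x^p`).
[cite: HardyLittlewoodPolya1952, Thm 378] -/
theorem lintegral_rpow_mul_posLog_le_of_volume_sublevel_le {ξ : ℝ → ℝ} {a b p θ A C : ℝ}
    (ha : 0 ≤ a) (hab : a < b) (hp : 0 < p) (hp1 : p ≤ 1) (hθ : 0 < θ) (hA : 0 ≤ A) (hC : 0 < C)
    (hξ : AEMeasurable ξ (volume.restrict (Icc a b)))
    (hsub : ∀ t, 0 < t → volume {u ∈ Icc a b | |ξ u| ≤ t} ≤ ENNReal.ofReal (A * t ^ θ)) :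
    ∫⁻ u in Icc a b, ENNReal.ofReal (p * u ^ (p - 1) * log⁺ (C / |ξ u|)) ≤
      ENNReal.ofReal ((b - a) ^ p * (θ⁻¹ * log⁺ (A * C ^ θ / (b - a)) + (p * θ)⁻¹)) := by
  have hL : 0 < b - a := sub_pos.2 hab
  set M : ℝ := A * C ^ θ with hM
  have hM0 : 0 ≤ M := mul_nonneg hA (rpow_nonneg hC.le θ)
  set m : ℝ → ℝ := fun τ => min (b - a) (M * exp (-θ * τ)) with hm
  have hm0 : ∀ τ, 0 < τ → 0 ≤ m τ := fun τ _ => le_min hL.le (mul_nonneg hM0 (exp_pos _).le)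
  have hmb : ∀ τ, 0 < τ → a + m τ ≤ b := fun τ _ => by
    have := min_le_left (b - a) (M * exp (-θ * τ)); rw [hm]; linarith
  have hξ' : AEMeasurable ξ (volume.restrict (Ioc a b)) :=
    hξ.mono_measure (Measure.restrict_mono Ioc_subset_Icc_self le_rfl)
  have hlevel : ∀ τ, 0 < τ →
      volume {u ∈ Ioc a b | τ < log⁺ (C / |ξ u|)} ≤ ENNReal.ofReal (m τ) :=
    fun τ hτ => volume_superlevel_posLog_le hC hsub hτ
  -- the weight `φ u = p u^{p-1}` is nonnegative and antitone on `(a, b] ⊆ (0, ∞)`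
  have hφ : AntitoneOn (fun u : ℝ => p * u ^ (p - 1)) (Ioc a b) := by
    intro u hu v hv huv
    have hu0 : 0 < u := ha.trans_lt hu.1
    exact mul_le_mul_of_nonneg_left (rpow_le_rpow_of_nonpos hu0 huv (by linarith)) hp.le
  have hφ0 : ∀ u ∈ Ioc a b, 0 ≤ p * u ^ (p - 1) := fun u hu =>
    mul_nonneg hp.le (rpow_nonneg (ha.trans hu.1.le) _)
  have key := lintegral_mul_le_of_antitoneOn_of_volume_superlevel_le hφ hφ0
    (aemeasurable_posLog_div_abs C hξ') (fun _ _ => posLog_nonneg) hm0 hmb hlevel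
  rw [setLIntegral_congr Ioc_ae_eq_Icc.symm]
  refine key.trans ?_
  -- inner integrals: `∫_{(a, a+x]} p u^{p-1} = (a+x)^p - a^p ≤ x^p`
  have inner : ∀ x, 0 ≤ x →
      ∫⁻ u in Ioc a (a + x), ENNReal.ofReal (p * u ^ (p - 1)) ≤ ENNReal.ofReal (x ^ p) := by
    intro x hx
    have hint : IntervalIntegrable (fun u : ℝ => p * u ^ (p - 1)) volume a (a + x) :=
      (intervalIntegral.intervalIntegrable_rpow' (by linarith)).const_mul p
    have hI : IntegrableOn (fun u : ℝ => p * u ^ (p - 1)) (Ioc a (a + x)) :=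
      (intervalIntegrable_iff_integrableOn_Ioc_of_le (by linarith)).1 hint
    rw [← ofReal_integral_eq_lintegral_ofReal hI
      (ae_restrict_of_forall_mem measurableSet_Ioc fun u hu =>
        mul_nonneg hp.le (rpow_nonneg (ha.trans hu.1.le) _))]
    refine ENNReal.ofReal_le_ofReal ?_
    rw [← intervalIntegral.integral_of_le (by linarith), intervalIntegral.integral_const_mul,
      integral_rpow (Or.inl (by linarith)), sub_add_cancel]
    have hsub' : (a + x) ^ p ≤ a ^ p + x ^ p := rpow_add_le_add_rpow ha hx hp.le hp1
    have : p * (((a + x) ^ p - a ^ p) / p) = (a + x) ^ p - a ^ p := by field_simp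
    rw [this]; linarith
  calc ∫⁻ τ in Ioi 0, ∫⁻ u in Ioc a (a + m τ), ENNReal.ofReal (p * u ^ (p - 1))
      ≤ ∫⁻ τ in Ioi 0, ENNReal.ofReal (min (b - a) (M * exp (-θ * τ)) ^ p) :=
        setLIntegral_mono' measurableSet_Ioi fun τ hτ => inner (m τ) (hm0 τ hτ)
    _ ≤ _ := lintegral_min_exp_rpow_le hL hM0 hθ hp

/-! ### Bochner-integral forms -/

/-- From a finite Lebesgue bound to integrability and the Bochner bound, for a nonnegative
a.e.-measurable integrand on a set. [cite: LiebLoss2001, Thm 1.13] -/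
theorem integrableOn_and_integral_le_of_lintegral_le {f : ℝ → ℝ} {s : Set ℝ} {B : ℝ}
    (hs : MeasurableSet s) (hf : AEMeasurable f (volume.restrict s)) (hf0 : ∀ u ∈ s, 0 ≤ f u)
    (hB : 0 ≤ B) (h : ∫⁻ u in s, ENNReal.ofReal (f u) ≤ ENNReal.ofReal B) :
    IntegrableOn f s ∧ ∫ u in s, f u ≤ B := by
  have h0 : 0 ≤ᵐ[volume.restrict s] f := ae_restrict_of_forall_mem hs hf0
  have hint : IntegrableOn f s :=
    ⟨hf.aestronglyMeasurable, (hasFiniteIntegral_iff_ofReal h0).2 (h.trans_lt ENNReal.ofReal_lt_top)⟩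
  refine ⟨hint, ?_⟩
  rw [integral_eq_lintegral_of_nonneg_ae h0 hf.aestronglyMeasurable]
  exact ENNReal.toReal_le_of_le_ofReal hB h

/-- **Unweighted logarithmic singularity (Bochner form).** Under the hypotheses of
`lintegral_posLog_le_of_volume_sublevel_le`: `u ↦ log⁺(C/|ξ u|)` is integrable on `[a, b]` and
`∫_{[a,b]} log⁺(C/|ξ u|) du ≤ (b-a) (θ⁻¹ log⁺(A C^θ/(b-a)) + θ⁻¹)`.
With `A = 2/g, θ = 1` (`|ξ'| ≥ g`): `(b-a)(log⁺(2C/(g(b-a))) + 1)`; with `A = 6/√δ, θ = 1/2`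
(`|ξ''| ≥ δ`): `(b-a)(2 log⁺(6√C/(√δ(b-a))) + 2)`. [cite: LiebLoss2001, Thm 1.13] -/
theorem integral_posLog_le_of_volume_sublevel_le {ξ : ℝ → ℝ} {a b θ A C : ℝ} (hab : a < b)
    (hθ : 0 < θ) (hA : 0 ≤ A) (hC : 0 < C) (hξ : AEMeasurable ξ (volume.restrict (Icc a b)))
    (hsub : ∀ t, 0 < t → volume {u ∈ Icc a b | |ξ u| ≤ t} ≤ ENNReal.ofReal (A * t ^ θ)) :
    IntegrableOn (fun u => log⁺ (C / |ξ u|)) (Icc a b) ∧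
      ∫ u in Icc a b, log⁺ (C / |ξ u|) ≤ (b - a) * (θ⁻¹ * log⁺ (A * C ^ θ / (b - a)) + θ⁻¹) :=
  integrableOn_and_integral_le_of_lintegral_le measurableSet_Icc (aemeasurable_posLog_div_abs C hξ)
    (fun _ _ => posLog_nonneg)
    (mul_nonneg (sub_pos.2 hab).le (add_nonneg (mul_nonneg (inv_nonneg.2 hθ.le) posLog_nonneg)
      (inv_nonneg.2 hθ.le)))
    (lintegral_posLog_le_of_volume_sublevel_le hab hθ hA hC hξ hsub)

/-- **Weighted logarithmic singularity (Bochner form).** Under the hypotheses of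
`lintegral_rpow_mul_posLog_le_of_volume_sublevel_le`: `u ↦ p u^{p-1} log⁺(C/|ξ u|)` is integrable
on `[a, b]` and `∫_{[a,b]} p u^{p-1} log⁺(C/|ξ u|) du ≤ (b-a)^p (θ⁻¹ log⁺(A C^θ/(b-a)) + (pθ)⁻¹)`
(`p = 1/2`: the weight `u^{-1/2}/2`; `p = 1/4`: `u^{-3/4}/4`).
[cite: HardyLittlewoodPolya1952, Thm 378] -/
theorem integral_rpow_mul_posLog_le_of_volume_sublevel_le {ξ : ℝ → ℝ} {a b p θ A C : ℝ}
    (ha : 0 ≤ a) (hab : a < b) (hp : 0 < p) (hp1 : p ≤ 1) (hθ : 0 < θ) (hA : 0 ≤ A) (hC : 0 < C)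
    (hξ : AEMeasurable ξ (volume.restrict (Icc a b)))
    (hsub : ∀ t, 0 < t → volume {u ∈ Icc a b | |ξ u| ≤ t} ≤ ENNReal.ofReal (A * t ^ θ)) :
    IntegrableOn (fun u => p * u ^ (p - 1) * log⁺ (C / |ξ u|)) (Icc a b) ∧
      ∫ u in Icc a b, p * u ^ (p - 1) * log⁺ (C / |ξ u|) ≤
        (b - a) ^ p * (θ⁻¹ * log⁺ (A * C ^ θ / (b - a)) + (p * θ)⁻¹) := by
  refine integrableOn_and_integral_le_of_lintegral_le measurableSet_Icc ?_
    (fun u hu => mul_nonneg (mul_nonneg hp.le (rpow_nonneg (ha.trans hu.1) _)) posLog_nonneg)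
    (mul_nonneg (rpow_nonneg (sub_pos.2 hab).le _) (add_nonneg
      (mul_nonneg (inv_nonneg.2 hθ.le) posLog_nonneg) (inv_nonneg.2 (mul_pos hp hθ).le)))
    (lintegral_rpow_mul_posLog_le_of_volume_sublevel_le ha hab hp hp1 hθ hA hC hξ hsub)
  exact ((measurable_const.mul ((measurable_id.pow_const _))).aemeasurable).mul
    (aemeasurable_posLog_div_abs C hξ)

/-! ### The order-one and order-two instances -/

/-- **Order one, increasing.** `ξ` continuous on `[a,b]`, differentiable on `(a,b)` with
`ξ' ≥ g > 0`; then for `C > 0`: `∫_{[a,b]} log⁺(C/|ξ u|) du ≤ (b-a)(log⁺(2C/(g(b-a))) + 1)`.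
[cite: CarberyChristWright1999, §1] -/
theorem integral_posLog_le_of_deriv_ge {ξ : ℝ → ℝ} {a b g C : ℝ} (hab : a < b) (hg : 0 < g)
    (hC : 0 < C) (hcont : ContinuousOn ξ (Icc a b)) (hdiff : DifferentiableOn ℝ ξ (Ioo a b))
    (hge : ∀ x ∈ Ioo a b, g ≤ deriv ξ x) :
    IntegrableOn (fun u => log⁺ (C / |ξ u|)) (Icc a b) ∧
      ∫ u in Icc a b, log⁺ (C / |ξ u|) ≤ (b - a) * (log⁺ (2 * C / (g * (b - a))) + 1) := by
  have h := integral_posLog_le_of_volume_sublevel_le (A := 2 / g) hab zero_lt_one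
    (div_nonneg zero_le_two hg.le) hC (hcont.aemeasurable measurableSet_Icc) fun t _ => by
      rw [rpow_one, show 2 / g * t = 2 * t / g by ring]
      exact volume_sublevel_Icc_le_of_deriv_ge t hg hcont hdiff hge
  refine ⟨h.1, h.2.trans_eq ?_⟩
  simp only [rpow_one, inv_one, one_mul]
  congr 2; field_simp

/-- **Order one, decreasing.** As `integral_posLog_le_of_deriv_ge` with `ξ' ≤ -g < 0`.
[cite: CarberyChristWright1999, §1] -/
theorem integral_posLog_le_of_deriv_le {ξ : ℝ → ℝ} {a b g C : ℝ} (hab : a < b) (hg : 0 < g)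
    (hC : 0 < C) (hcont : ContinuousOn ξ (Icc a b)) (hdiff : DifferentiableOn ℝ ξ (Ioo a b))
    (hle : ∀ x ∈ Ioo a b, deriv ξ x ≤ -g) :
    IntegrableOn (fun u => log⁺ (C / |ξ u|)) (Icc a b) ∧
      ∫ u in Icc a b, log⁺ (C / |ξ u|) ≤ (b - a) * (log⁺ (2 * C / (g * (b - a))) + 1) := by
  have h := integral_posLog_le_of_volume_sublevel_le (A := 2 / g) hab zero_lt_one
    (div_nonneg zero_le_two hg.le) hC (hcont.aemeasurable measurableSet_Icc) fun t _ => by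
      rw [rpow_one, show 2 / g * t = 2 * t / g by ring]
      exact volume_sublevel_Icc_le_of_deriv_le t hg hcont hdiff hle
  refine ⟨h.1, h.2.trans_eq ?_⟩
  simp only [rpow_one, inv_one, one_mul]
  congr 2; field_simp

/-- **Order two, convex.** `ξ` differentiable on `[a,b]` with derivative `ξ'` continuous on
`[a,b]` and differentiable on `(a,b)` with `(ξ')' ≥ δ > 0`; then for `C > 0`:
`∫_{[a,b]} log⁺(C/|ξ u|) du ≤ (b-a)(2 log⁺((6/√δ) √C/(b-a)) + 2)`.
[cite: CarberyChristWright1999, §1] -/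
theorem integral_posLog_le_of_second_deriv_ge {ξ ξ' : ℝ → ℝ} {a b δ C : ℝ} (hab : a < b)
    (hδ : 0 < δ) (hC : 0 < C) (hξ : ∀ x ∈ Icc a b, HasDerivAt ξ (ξ' x) x)
    (hcont' : ContinuousOn ξ' (Icc a b)) (hdiff' : DifferentiableOn ℝ ξ' (Ioo a b))
    (hge : ∀ x ∈ Ioo a b, δ ≤ deriv ξ' x) :
    IntegrableOn (fun u => log⁺ (C / |ξ u|)) (Icc a b) ∧
      ∫ u in Icc a b, log⁺ (C / |ξ u|) ≤
        (b - a) * (2 * log⁺ (6 / Real.sqrt δ * C ^ (1 / 2 : ℝ) / (b - a)) + 2) := by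
  have hcont : ContinuousOn ξ (Icc a b) := fun x hx => (hξ x hx).continuousAt.continuousWithinAt
  have h := integral_posLog_le_of_volume_sublevel_le (A := 6 / Real.sqrt δ) (θ := 1 / 2) hab
    (by norm_num) (div_nonneg (by norm_num) (Real.sqrt_nonneg _)) hC
    (hcont.aemeasurable measurableSet_Icc) fun t ht => by
      refine (volume_sublevel_Icc_le_of_second_deriv_ge ht hδ hξ hcont' hdiff' hge).trans_eq ?_
      rw [Real.sqrt_div ht.le, Real.sqrt_eq_rpow t]; ring_nf
  refine ⟨h.1, h.2.trans_eq ?_⟩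
  norm_num

end Literature.Analysis.Fourier

end
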